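import Summits.CriticalPhenomena.SAWScalingLimit.Theorems.SAWDefectDecoherenceBoundaryClosureRPolygonGreenMesh
import Summits.CriticalPhenomena.SAWScalingLimit.Theorems.SAWDefectDecoherenceBoundaryClosureRPolygonGreenBoundary
import HarnessLib

/-!
# Polygon Green pairing, V: the discrete Green pairing with explicit boundary dart term
(registered stub `polygonGreenPairing`; crux `BoundaryClosureR`, stmt-CriticalPhenomena-14004, line
`polygon-parity-squeeze`, mechanism (A1a), sub-goal of `stub_polygonIdentification`)

For ANY admissible pinned family (no polygon structure), with a boundary layer budget at every boundary
point except the root, `DefectDecoherence` and `MassRatio`, and every smooth `φ` compactly supported away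
from the root `pt 0` (the support may cross `∂Ω` anywhere else):
`N_δ(∂̄φ) − 6δ Σ_{darts v ∈ Λ_δ, t ∉ Λ_δ, v ∼ t} φ(δ c_v)(mid_{vt} − c_v) F(vt)/F(b_δ) → 0` as `δ → 0⁺`.
This is DCS Lemma 1 summed against `φ(δ c_v)` (`HexObservableLimitR.greenLimit_identity`) with the boundary
dart term kept explicit; it generalises the landed gate case `…GateDbarLimit.lean`.

PROOF.  `N_δ(∂̄φ) − 6δ·(dart sum) = −T_δ(∂φ) − 6E_δ + Q_δ` exactly (twisted term, Taylor remainder, boundary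
part of `N_δ`).  Cover (`exists_budget_cover`): `supp φ` thickened by `η₀` meets `∂Ω` in a compact set
missing `pt 0`, covered by finitely many budget balls; what is left of the thickened support inside `Ω̄` is a
compact `T ⊆ Ω`, whose `η₁`-thickening `K'` is still in `Ω`: by exhaustion its vertices are `(η₁/δ)`-deep and
`MassRatio` bounds the mass of `K'`.  Then `…PolygonGreenMesh.lean`: `‖T_δ‖ = O(δ^s + δ^{1/4})`
(`DefectDecoherence`, `s = min(θ − 3/4, 1/2)`), `‖E_δ‖ = O(δ^{1/4})`; and `…PolygonGreenBoundary.lean`: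
`‖Q_δ‖ = O(δ)` (dangling masses at depth-zero vertices off the root vertex, which sees no `φ`).
References: Duminil-Copin–Smirnov, Ann. of Math. 175 (2012), §3 and Conjecture 2.
-/

noncomputable section

open scoped BigOperators Topology Classical ComplexConjugate ContDiff
open Filter Set Metric Complex MeasureTheory
open Literature.Probability.LatticeModels Literature.Probability.RandomPlanarGeometry
open Literature.Probability.RandomPlanarGeometry.SAW
open Literature.Barriers.CriticalPhenomena.HexGreen (nbrs mem_nbrs_iff satisfiesVertexRelations_iff_sum)
open Literature.Analysis.Complex (dbarAlong dbarAlong_one dbarAlong_eq_zero_of_notMem_tsupport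
  hasCompactSupport_dbarAlong_one)
open Summit.CriticalPhenomena.SAWScalingLimit.Theses.SAWDefectDecoherence
open Summit.CriticalPhenomena.SAWScalingLimit.Theorems.PickHalfPlane
open Summit.CriticalPhenomena.SAWScalingLimit.Theorems.HexObservableLimitR (greenLimit_identity
  greenLimit_taylor_symm)
open Summit.CriticalPhenomena.SAWScalingLimit.Theorems.ObservableToSLE.FloorRatio (dist_smul_mesh)
open Summit.CriticalPhenomena.SAWScalingLimit.Theorems.DecoherenceSynthesis (norm_hexMidpoint_sub_hexCenter_le)
open Summit.CriticalPhenomena.SAWScalingLimit.Theorems.PolygonParitySqueeze.GateDbar (dbarAlong_one_eq_div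
  contDiff_dAlong_div dAlong_eq_zero_of_notMem tendsto_majorant finsum_midEdges_split)

namespace Summit.CriticalPhenomena.SAWScalingLimit.Theorems.PolygonParitySqueeze.PolygonGreen

/-! ### 1. The cover -/

/-- **Budget cover of the support.** `Ω` open, `S` compact, `p ∉ S`, and a "budget" `P z r` available on
some ball around every point of `∂Ω` other than `p`.  Then there are `η₀, η₁ > 0`, finitely many centres
`t ⊆ ∂Ω` with radii `r` carrying budgets, and a set `T` with compact `η₁`-thickening inside `Ω`, such that
the `2η₀`-ball at `p` misses `S` and every point of `Ω` in the `η₀`-thickening of `S` lies in a budget ball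
or in `T`. [folklore] -/
theorem exists_budget_cover {Ω S : Set ℂ} {p : ℂ} (hΩ : IsOpen Ω) (hS : IsCompact S) (hpS : p ∉ S)
    (P : ℂ → ℝ → Prop) (hP : ∀ z ∈ frontier Ω, z ≠ p → ∃ r, 0 < r ∧ P z r) :
    ∃ (η₀ η₁ : ℝ) (t : Finset ℂ) (r : ℂ → ℝ) (T : Set ℂ),
      0 < η₀ ∧ 0 < η₁ ∧ (∀ y, dist y p < 2 * η₀ → y ∉ S) ∧ (∀ x ∈ t, 0 < r x ∧ P x (r x)) ∧
      IsCompact (cthickening η₁ T) ∧ cthickening η₁ T ⊆ Ω ∧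
      ∀ y ∈ Ω, y ∈ cthickening η₀ S → (∃ x ∈ t, y ∈ ball x (r x)) ∨ y ∈ T := by
  -- a ball around `p` missing `S`
  obtain ⟨ε, hε, hεS⟩ := Metric.isOpen_iff.1 hS.isClosed.isOpen_compl p hpS
  have hfar : ∀ y, dist y p < 2 * (ε / 2) → y ∉ S := fun y hy hyS => hεS (mem_ball.2 (by linarith)) hyS
  have hpS' : p ∉ cthickening (ε / 2) S := fun h => by
    have h' := cthickening_subset_thickening' hε (by linarith : ε / 2 < ε) S h
    obtain ⟨z, hz, hdz⟩ := mem_thickening_iff.1 h'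
    exact hεS (mem_ball.2 (by rw [dist_comm]; exact hdz)) hz
  have hS'c : IsCompact (cthickening (ε / 2) S) := hS.cthickening
  have hFc : IsCompact (cthickening (ε / 2) S ∩ frontier Ω) := hS'c.inter_right isClosed_frontier
  choose! r hr using hP
  obtain ⟨t, htF, hcover⟩ := hFc.elim_nhds_subcover (fun z => ball z (r z)) fun z hz =>
    ball_mem_nhds z (hr z hz.2 fun h => hpS' (h ▸ hz.1)).1
  set U : Set ℂ := ⋃ x ∈ t, ball x (r x) with hU
  have hUo : IsOpen U := isOpen_biUnion fun _ _ => isOpen_ball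
  set T : Set ℂ := cthickening (ε / 2) S ∩ closure Ω ∩ Uᶜ with hT
  have hTc : IsCompact T := (hS'c.inter_right isClosed_closure).inter_right hUo.isClosed_compl
  have hTΩ : T ⊆ Ω := by
    rintro y ⟨⟨hyS', hycl⟩, hyU⟩
    rw [closure_eq_self_union_frontier] at hycl
    rcases hycl with h | h
    · exact h
    · exact absurd (hcover ⟨hyS', h⟩) hyU
  obtain ⟨η₁, hη₁, hK⟩ := hTc.exists_cthickening_subset_open hΩ hTΩ
  refine ⟨ε / 2, η₁, t, r, T, by positivity, hη₁, hfar,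
    fun x hx => hr x (htF x hx).2 fun h => hpS' (h ▸ (htF x hx).1), hTc.cthickening, hK, fun y hyΩ hyS' => ?_⟩
  by_cases hyU : y ∈ U
  · left
    simpa only [hU, mem_iUnion, exists_prop] using hyU
  · exact Or.inr ⟨⟨hyS', subset_closure hyΩ⟩, hyU⟩

/-! ### 2. The pairing -/

set_option maxHeartbeats 400000 in
/-- **The discrete Green pairing with explicit boundary dart term.** For an admissible pinned family with
boundary layer budgets off the root, `DefectDecoherence` and `MassRatio`, and a smooth `φ` compactly
supported away from `pt 0`:
`N_δ(∂̄φ) − 6δ Σ_{darts (v ∈ Λ_δ, t ∉ Λ_δ)} φ(δ c_v)(mid − c_v) F(vt)/F(b_δ) → 0`.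
[cite: DuminilCopinSmirnov2012, §3 (Lemma 1, summation by parts)] -/
theorem polygonGreenPairing_of {D : DobrushinDomain} {ρ : ℝ} {Λ : ℝ → Finset HexVertex} {m : ℝ → ℤ}
    {b : ℝ → Sym2 HexVertex} (hAF : AdmissibleFamily D ρ Λ m b) {a : ℝ → Sym2 HexVertex} {r₀ : ℝ}
    {m₀ : ℝ → ℤ} (hPR : PinnedFlatRoot D Λ b (D.pt 0) a r₀ m₀)
    (hBL : ∀ z ∈ frontier D.carrier, z ≠ D.pt 0 → BoundaryLayerBudgetAt Λ a b z)
    (hDD : DefectDecoherence) (hMR : MassRatio) {φ : ℂ → ℂ} (hφ : ContDiff ℝ ∞ φ)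
    (hφc : HasCompactSupport φ) (hφ0 : D.pt 0 ∉ tsupport φ) :
    Tendsto (fun δ : ℝ => NF Λ a b δ (dbarAlong 1 φ)
      - 6 * (δ : ℂ) * ∑ᶠ p ∈ {p : HexVertex × HexVertex | p.1 ∈ Λ δ ∧ p.2 ∉ Λ δ ∧ hexGraph.Adj p.1 p.2},
          φ ((δ : ℂ) * hexCenter p.1) * (hexMidpoint s(p.1, p.2) - hexCenter p.1) *
            (hexParafermionicObservable (Λ δ) (a δ) hexCriticalFugacity (5 / 8) s(p.1, p.2) /
              hexParafermionicObservable (Λ δ) (a δ) hexCriticalFugacity (5 / 8) (b δ)))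
      (𝓝[>] 0) (𝓝 0) := by
  obtain ⟨hρ, hflat, hadm, hexh, hbt⟩ := hAF
  obtain ⟨-, -, hroot, hat⟩ := hPR
  ---------------------------------------------------------------- the cover and its constants
  obtain ⟨η₀, η₁, t, r, T, hη₀, hη₁, hfar, htP, hK'c, hK'Ω, hsplit⟩ := exists_budget_cover D.isOpen hφc hφ0
    (fun z r => ∃ C : ℝ, ∀ᶠ δ : ℝ in 𝓝[>] 0, ∀ k : ℕ,
      δ * (∑ᶠ v ∈ {v : HexVertex | v ∈ Λ δ ∧ (δ : ℂ) * hexCenter v ∈ ball z r ∧ IsMetricDepth (Λ δ) v k},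
        starMass (Λ δ) (a δ) v) ≤
      C * ((k : ℝ) + 1) ^ (3 / 4 : ℝ) * ‖hexParafermionicObservable (Λ δ) (a δ) hexCriticalFugacity 0 (b δ)‖)
    (fun z hz hzp => by obtain ⟨r, C, hr, h⟩ := hBL z hz hzp; exact ⟨r, hr, C, h⟩)
  choose! Cb hCb using fun x (hx : x ∈ t) => (htP x hx).2
  set Cb' : ℂ → ℝ := fun x => max (Cb x) 0 with hCb'
  have hCb'0 : ∀ x ∈ t, 0 ≤ Cb' x := fun x _ => le_max_right _ _
  have hbudev := (t.eventually_all).2 hCb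
  ---------------------------------------------------------------- `MassRatio` on the bulk compact
  set K' : Set ℂ := cthickening η₁ T with hK'
  have hadm' : ∀ᶠ δ : ℝ in 𝓝[>] 0, hexDomainSimplyConnected (Λ δ) ∧ a δ ∈ hexDomainBoundary (Λ δ) ∧
      b δ ∈ hexDomainBoundary (Λ δ) ∧ Nonempty (HexMidEdgeSAW (Λ δ) (a δ) (b δ)) ∧
      (hexGraph.induce ((Λ δ : Finset HexVertex) : Set HexVertex)).Preconnected ∧
      (∀ v ∈ Λ δ, (δ : ℂ) * hexCenter v ∈ D.carrier) ∧
      (∀ v : HexVertex, (δ : ℂ) * hexCenter v ∈ ball (D.pt 1) ρ → (v ∈ Λ δ ↔ m δ ≤ v.1 1)) := by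
    filter_upwards [hadm, hroot] with δ h h'
    exact ⟨h.1, h'.1, h.2.1, h'.2.1, h.2.2.1, h.2.2.2.1, h.2.2.2.2⟩
  obtain ⟨CMR, hMRev⟩ := hMR D ρ Λ m a b hρ hflat hadm' hexh hat hbt K' hK'c hK'Ω
  set CMR' : ℝ := max CMR 0 with hCMR'
  have hCMR'0 : 0 ≤ CMR' := le_max_right _ _
  have hexhK := hexh K' hK'c hK'Ω
  ---------------------------------------------------------------- the domain is bounded
  obtain ⟨R₀, hR₀⟩ := (Metric.isBounded_iff_subset_closedBall 0).1 D.isBounded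
  set Rd : ℝ := max (2 * R₀) 1 with hRd
  have hRd1 : 1 ≤ Rd := le_max_right _ _
  ---------------------------------------------------------------- analytic constants
  have hφ3 : ContDiff ℝ 3 φ := hφ.of_le (by
    change ((3 : ℕ∞) : WithTop ℕ∞) ≤ ((⊤ : ℕ∞) : WithTop ℕ∞); exact WithTop.coe_le_coe.2 le_top)
  obtain ⟨M, hM0, hM⟩ := greenLimit_taylor_symm hφ3 hφc
  set ψ₂ : ℂ → ℂ := fun z => (fderiv ℝ φ z 1 - I * fderiv ℝ φ z I) / 2 with hψ₂def
  have hψ₂d : ContDiff ℝ 1 ψ₂ := contDiff_dAlong_div hφ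
  have hψ₂K : ∀ z, z ∉ tsupport φ → ψ₂ z = 0 := fun z hz => dAlong_eq_zero_of_notMem hz
  have hψ₂c : HasCompactSupport ψ₂ := HasCompactSupport.intro hφc hψ₂K
  have hψ₂s : ∀ z, ψ₂ z ≠ 0 → z ∈ tsupport φ := fun z hz => by by_contra h; exact hz (hψ₂K z h)
  obtain ⟨Mψ, hMψ⟩ := hψ₂d.continuous.bounded_above_of_compact_support hψ₂c
  obtain ⟨Kψ, hKψ⟩ := hψ₂d.lipschitzWith_of_hasCompactSupport hψ₂c one_ne_zero
  have hψL : ∀ x y, ‖ψ₂ x - ψ₂ y‖ ≤ (Kψ : ℝ) * ‖x - y‖ := fun x y => by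
    rw [← dist_eq_norm, ← dist_eq_norm]; exact hKψ.dist_le_mul x y
  have hMψ0 : 0 ≤ Mψ := (norm_nonneg _).trans (hMψ 0)
  have hψ₁s : ∀ z, dbarAlong 1 φ z ≠ 0 → z ∈ tsupport φ := fun z hz => by
    by_contra h; exact hz (dbarAlong_eq_zero_of_notMem_tsupport h)
  obtain ⟨M₁, hM₁⟩ := (Engine.continuous_dbarAlong_one hφ).bounded_above_of_compact_support
    (hasCompactSupport_dbarAlong_one hφc)
  have hM₁0 : 0 ≤ M₁ := (norm_nonneg _).trans (hM₁ 0)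
  ---------------------------------------------------------------- route constants
  obtain ⟨C, θ, hθ, hDDall⟩ := hDD
  set s : ℝ := min (θ - 3 / 4) (1 / 2) with hsdef
  have hs0 : 0 < s := lt_min (by linarith) (by norm_num)
  have hs1 : s < 1 := (min_le_right _ _).trans_lt (by norm_num)
  have hsθ : -θ + 3 / 4 ≤ -s := by have := min_le_left (θ - 3 / 4) (1 / 2); rw [hsdef]; linarith
  set A₀ : ℝ := max (1 / 2) (C * 2 ^ θ) with hA₀
  set C' : ℝ := max C 0 with hC'
  ---------------------------------------------------------------- the majorant
  set gA : ℝ := (∑ x ∈ t, 6 * Cb' x * (Mψ * A₀ * ((2 * Rd) ^ (1 - s) / (1 - s)))) +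
    12 * CMR' * (Mψ * C' * η₁ ^ (-θ)) with hgA
  set gB : ℝ := (∑ x ∈ t, 6 * Cb' x * ((Kψ : ℝ) / 4 * (2 * Rd) ^ (7 / 4 : ℝ))) + 12 * CMR' * ((Kψ : ℝ) / 4) +
    6 * (M / 8 * (∑ x ∈ t, Cb' x * (2 * Rd) ^ (7 / 4 : ℝ) + 2 * CMR')) with hgB
  set gC : ℝ := 3 * M₁ * ∑ x ∈ t, Cb' x with hgC
  refine squeeze_zero_norm' ?_ (tendsto_majorant gA gB gC hs0)
  ---------------------------------------------------------------- eventual lattice facts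
  have hnormev := LocalL1.eventually_normaliser_ne_zero_of_bundles hadm hroot
  have hsmall : ∀ᶠ δ : ℝ in 𝓝[>] 0, δ < min (min η₀ η₁) 1 / 2 := by
    have : Iio (min (min η₀ η₁) 1 / 2) ∈ 𝓝 (0 : ℝ) := Iio_mem_nhds (by positivity)
    exact mem_nhdsWithin_of_mem_nhds this
  have hanear : ∀ᶠ δ : ℝ in 𝓝[>] 0, dist ((δ : ℂ) * hexMidpoint (a δ)) (D.pt 0) < η₀ :=
    Metric.tendsto_nhds.1 hat η₀ hη₀
  filter_upwards [self_mem_nhdsWithin, hsmall, hadm, hroot, hnormev, hbudev, hMRev, hexhK, hanear]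
    with δ hδ0 hδs hadmδ hrootδ hnormδ hbudδ hMRδ hexhδ hanearδ
  have hδ : 0 < δ := hδ0
  have hmin1 : min (min η₀ η₁) 1 ≤ η₀ := (min_le_left _ _).trans (min_le_left _ _)
  have hmin2 : min (min η₀ η₁) 1 ≤ η₁ := (min_le_left _ _).trans (min_le_right _ _)
  have hmin3 : min (min η₀ η₁) 1 ≤ 1 := min_le_right _ _
  have hδη₀ : δ ≤ η₀ / 2 := by linarith
  have hδη₁ : δ ≤ η₁ := by linarith
  have hδ1 : δ ≤ 1 := by linarith
  have hδRd : δ ≤ Rd := hδ1.trans hRd1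
  obtain ⟨hsc, -, -, hcar, -⟩ := hadmδ
  obtain ⟨habd, -, -⟩ := hrootδ
  obtain ⟨haE, u, w, hauw, hw, hu⟩ := habd
  have huw : hexGraph.Adj u w := by rw [hauw] at haE; exact (SimpleGraph.mem_edgeSet hexGraph).1 haE
  have habd' : s(u, w) ∈ hexDomainBoundary (Λ δ) := ⟨by rw [← hauw]; exact haE, u, w, rfl, hw, hu⟩
  simp only [NF]
  rw [hauw] at hnormδ hbudδ hMRδ hanearδ
  rw [hauw]
  set Λδ := Λ δ with hΛδ
  set b' := b δ with hb'
  set F : Sym2 HexVertex → ℂ := hexParafermionicObservable Λδ s(u, w) hexCriticalFugacity (5 / 8) with hFdef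
  set Z : Sym2 HexVertex → ℂ := hexParafermionicObservable Λδ s(u, w) hexCriticalFugacity 0 with hZdef
  obtain ⟨hFb0, hFbZ⟩ := hnormδ
  have hZbpos : 0 < ‖Z b'‖ := by rw [← hFbZ]; exact norm_pos_iff.2 hFb0
  ---------------------------------------------------------------- the Green identity at mesh δ
  have hVR : ∀ v ∈ Λδ, ∑ w' ∈ nbrs v, Literature.Barriers.CriticalPhenomena.HexKernel.term F v w' = 0 :=
    (satisfiesVertexRelations_iff_sum _ _).1 (Dressed.satisfiesVertexRelations_observable hsc habd')
  have hid := greenLimit_identity Λδ F (F b') δ φ hVR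
  have hA : (δ : ℂ) ^ 2 * (∑ v ∈ Λδ.filter (fun v => v.2 = 0), ∑ t ∈ Λδ.filter (fun t => hexGraph.Adj v t),
      dbarAlong 1 φ ((δ : ℂ) * hexMidpoint s(v, t)) * F s(v, t)) / F b' =
      ∑ v ∈ Λδ.filter (fun v => v.2 = 0), ∑ t ∈ Λδ.filter (fun t => hexGraph.Adj v t),
        (fderiv ℝ φ ((δ : ℂ) * hexMidpoint s(v, t)) 1 + I * fderiv ℝ φ ((δ : ℂ) * hexMidpoint s(v, t)) I) / 2 *
          ((δ : ℂ) ^ 2 * F s(v, t) / F b') := by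
    rw [Finset.mul_sum, Finset.sum_div]
    refine Finset.sum_congr rfl fun v _ => ?_
    rw [Finset.mul_sum, Finset.sum_div]
    refine Finset.sum_congr rfl fun t _ => ?_
    rw [dbarAlong_one_eq_div]; ring
  rw [finsum_midEdges_split Λδ, mul_add, add_div, hA, hid]
  -- the dart sum of the statement is the dart sum of the identity
  have hds := sum_darts_eq_finsum Λδ (fun p : HexVertex × HexVertex => φ ((δ : ℂ) * hexCenter p.1) *
    (hexMidpoint s(p.1, p.2) - hexCenter p.1) * (F s(p.1, p.2) / F b'))
  simp only [Set.mem_setOf_eq] at hds ⊢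
  rw [← hds]
  have hDart : ∑ v ∈ Λδ, ∑ t ∈ (nbrs v).filter (· ∉ Λδ),
      φ ((δ : ℂ) * hexCenter v) * (hexMidpoint s(v, t) - hexCenter v) * (F s(v, t) / F b') =
      ∑ v ∈ Λδ, ∑ t ∈ (nbrs v).filter (· ∉ Λδ),
        φ ((δ : ℂ) * hexCenter v) * ((hexMidpoint s(v, t) - hexCenter v) * F s(v, t)) / F b' :=
    Finset.sum_congr rfl fun v _ => Finset.sum_congr rfl fun t _ => by ring
  rw [hDart]
  rw [show ∀ (P T E Q : ℂ), 6 * ((δ : ℂ) * P) - T - 6 * E + Q - 6 * (δ : ℂ) * P = (-T) + (-(6 * E)) + Q from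
    fun P T E Q => by ring]
  refine (norm_add₃_le).trans ?_
  rw [norm_neg, norm_neg, norm_mul, Complex.norm_ofNat]
  ---------------------------------------------------------------- one-mesh data for the three bounds
  -- depth bound
  have hΛnorm : ∀ y ∈ Λδ, ‖(δ : ℂ) * hexCenter y‖ ≤ R₀ := fun y hy =>
    mem_closedBall_zero_iff.1 (hR₀ (hcar y hy))
  set K : ℕ := ⌊Rd / δ⌋₊ with hKdef
  have hKle : (K : ℝ) ≤ Rd / δ := Nat.floor_le (by positivity)
  have hdepthK : ∀ v ∈ Λδ, ∀ k : ℕ, IsMetricDepth Λδ v k → k ≤ K := by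
    intro v _ k hk
    have h1 := mul_le_of_isMetricDepth hδ.le hΛnorm hk
    have h2 : (k : ℝ) ≤ Rd / δ := by
      rw [le_div_iff₀ hδ]
      calc (k : ℝ) * δ = δ * k := mul_comm _ _
        _ ≤ 2 * R₀ := h1
        _ ≤ Rd := le_max_left _ _
    exact Nat.le_floor h2
  -- decoherence at this `Λ`
  have hDDδ := hDDall Λδ hsc u w huw hu hw
  -- budgets with non-negative constants
  have hbudget : ∀ x ∈ t, ∀ k : ℕ, δ * (∑ᶠ v ∈ {v : HexVertex | v ∈ Λδ ∧ (δ : ℂ) * hexCenter v ∈ ball x (r x) ∧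
      IsMetricDepth Λδ v k}, starMass Λδ s(u, w) v) ≤ Cb' x * ((k : ℝ) + 1) ^ (3 / 4 : ℝ) * ‖Z b'‖ :=
    fun x hx k => (hbudδ x hx k).trans (mul_le_mul_of_nonneg_right (mul_le_mul_of_nonneg_right (le_max_left _ _)
      (Real.rpow_nonneg (by positivity) _)) (norm_nonneg _))
  -- `MassRatio` with a non-negative constant
  have hMR' : δ ^ 2 * (∑ᶠ z ∈ {z : Sym2 HexVertex | z ∈ hexDomainMidEdges Λδ ∧ (δ : ℂ) * hexMidpoint z ∈ K'},
      ‖Z z‖) ≤ CMR' * δ ^ (-(3 : ℝ) / 4) * ‖Z b'‖ :=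
    hMRδ.trans (mul_le_mul_of_nonneg_right (mul_le_mul_of_nonneg_right (le_max_left _ _)
      (Real.rpow_nonneg hδ.le _)) (norm_nonneg _))
  -- bulk vertices are deep, bulk stars lie in `K'`
  have hdeep : ∀ v ∈ Λδ, (δ : ℂ) * hexCenter v ∈ T →
      ∀ y : HexVertex, dist (hexCenter y) (hexCenter v) ≤ η₁ / δ → y ∈ Λδ := by
    intro v _ hvT y hy
    refine hexhδ y (mem_cthickening_of_dist_le _ _ _ _ hvT ?_)
    rw [dist_smul_mesh hδ.le]
    rwa [le_div_iff₀ hδ, mul_comm] at hy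
  have hTK : ∀ v ∈ Λδ, (δ : ℂ) * hexCenter v ∈ T → ∀ t' ∈ Λδ, hexGraph.Adj v t' →
      (δ : ℂ) * hexMidpoint s(v, t') ∈ K' := by
    intro v _ hvT t' _ hadj
    refine mem_cthickening_of_dist_le _ _ _ _ hvT ?_
    rw [dist_smul_mesh hδ.le, dist_eq_norm]
    exact (mul_le_mul_of_nonneg_left (norm_hexMidpoint_sub_hexCenter_le hadj) hδ.le).trans (by linarith)
  -- the splits
  have hsplitS : ∀ η : ℝ, η ≤ η₀ → ∀ v ∈ Λδ, (δ : ℂ) * hexCenter v ∈ cthickening η (tsupport φ) →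
      (∃ x ∈ t, (δ : ℂ) * hexCenter v ∈ ball x (r x)) ∨ (δ : ℂ) * hexCenter v ∈ T :=
    fun η hη v hv hvS => hsplit _ (hcar v hv) (cthickening_mono hη _ hvS)
  -- the root vertex sees no `φ`
  have hroot0 : ∀ t' : HexVertex, hexGraph.Adj w t' → dbarAlong 1 φ ((δ : ℂ) * hexMidpoint s(w, t')) = 0 := by
    intro t' hwt
    refine dbarAlong_eq_zero_of_notMem_tsupport (hfar _ ?_)
    have h1 : dist ((δ : ℂ) * hexMidpoint s(w, t')) ((δ : ℂ) * hexCenter w) ≤ δ / 2 := by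
      rw [dist_smul_mesh hδ.le, dist_eq_norm]
      exact (mul_le_mul_of_nonneg_left (norm_hexMidpoint_sub_hexCenter_le hwt) hδ.le).trans (by linarith)
    have h2 : dist ((δ : ℂ) * hexCenter w) ((δ : ℂ) * hexMidpoint s(u, w)) ≤ δ / 2 := by
      rw [dist_comm, dist_smul_mesh hδ.le, dist_eq_norm, Sym2.eq_swap]
      exact (mul_le_mul_of_nonneg_left (norm_hexMidpoint_sub_hexCenter_le huw.symm) hδ.le).trans (by linarith)
    linarith [dist_triangle4 ((δ : ℂ) * hexMidpoint s(w, t')) ((δ : ℂ) * hexCenter w)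
      ((δ : ℂ) * hexMidpoint s(u, w)) (D.pt 0)]
  ---------------------------------------------------------------- the three bounds
  have hT := twisted_mesh_le (ψ := ψ₂) (S := tsupport φ) hδ hδRd hδη₁ hδ1 hKle hdepthK hs0 hs1 hsθ hDDδ hCb'0
    hbudget hCMR'0 hMR' hdeep hTK (hsplitS (δ / 2) (by linarith)) hMψ (NNReal.coe_nonneg Kψ) hψL hψ₂s hFbZ hZbpos
  have hE := remainder_mesh_le (φ := φ) hδ hδRd hKle hdepthK hCb'0 hbudget hMR' hTK (re := η₀ / 2) hδη₀
    (hsplitS (η₀ / 2 + δ / 2) (by linarith)) hM0 hM hFbZ hZbpos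
  have hQ := boundary_mesh_le (ψ := dbarAlong 1 φ) (S := tsupport φ) hu hδ hδη₁ hdepthK hCb'0 hbudget hdeep
    (hsplitS (δ / 2) (by linarith)) hM₁ hψ₁s hroot0 hFbZ hZbpos
  have hsum : ∑ x ∈ t, 6 * Cb' x * (Mψ * max (1 / 2) (C * 2 ^ θ) * ((2 * Rd) ^ (1 - s) / (1 - s)) * δ ^ s +
        (Kψ : ℝ) / 4 * ((2 * Rd) ^ (7 / 4 : ℝ) * δ ^ (1 / 4 : ℝ))) =
      (∑ x ∈ t, 6 * Cb' x * (Mψ * A₀ * ((2 * Rd) ^ (1 - s) / (1 - s)))) * δ ^ s +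
        (∑ x ∈ t, 6 * Cb' x * ((Kψ : ℝ) / 4 * (2 * Rd) ^ (7 / 4 : ℝ))) * δ ^ (1 / 4 : ℝ) := by
    rw [Finset.sum_mul, Finset.sum_mul, ← Finset.sum_add_distrib]
    exact Finset.sum_congr rfl fun x _ => by rw [hA₀]; ring
  have hfin := add_le_add (add_le_add hT (mul_le_mul_of_nonneg_left hE (by norm_num : (0 : ℝ) ≤ 6))) hQ
  rw [hsum] at hfin
  refine hfin.trans (le_of_eq ?_)
  simp only [hgA, hgB, hgC, hC']
  ring

/-- **Registered stub `polygonGreenPairing`** (crux item stmt-CriticalPhenomena-14004, line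
`polygon-parity-squeeze`, sub-goal (A1a) of `stub_polygonIdentification`): the discrete Green pairing with
EXPLICIT boundary dart term for any admissible pinned family with boundary layer budgets off the root,
`DefectDecoherence` and `MassRatio`. [cite: DuminilCopinSmirnov2012, §3 (Lemma 1, summation by parts)] -/
theorem polygonGreenPairing : ∀ (D : DobrushinDomain) (ρ : ℝ) (Λ : ℝ → Finset HexVertex) (m : ℝ → ℤ) (b : ℝ → Sym2 HexVertex), AdmissibleFamily D ρ Λ m b → ∀ (a : ℝ → Sym2 HexVertex) (r₀ : ℝ) (m₀ : ℝ → ℤ), PinnedFlatRoot D Λ b (D.pt 0) a r₀ m₀ → (∀ z ∈ frontier D.carrier, z ≠ D.pt 0 → BoundaryLayerBudgetAt Λ a b z) → DefectDecoherence → MassRatio → ∀ (φ : ℂ → ℂ), ContDiff ℝ ∞ φ → HasCompactSupport φ → D.pt 0 ∉ tsupport φ → Filter.Tendsto (fun δ : ℝ => NF Λ a b δ (Literature.Analysis.Complex.dbarAlong 1 φ) - 6 * (δ : ℂ) * ∑ᶠ p ∈ {p : HexVertex × HexVertex | p.1 ∈ Λ δ ∧ p.2 ∉ Λ δ ∧ hexGraph.Adj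 p.1 p.2}, φ ((δ : ℂ) * hexCenter p.1) * (hexMidpoint s(p.1, p.2) - hexCenter p.1) * (hexParafermionicObservable (Λ δ) (a δ) hexCriticalFugacity (5 / 8) s(p.1, p.2) / hexParafermionicObservable (Λ δ) (a δ) hexCriticalFugacity (5 / 8) (b δ))) (𝓝[>] 0) (𝓝 0) :=
  fun _ _ _ _ _ hAF _ _ _ hPR hBL hDD hMR _ hφ hφc hφ0 => polygonGreenPairing_of hAF hPR hBL hDD hMR hφ hφc hφ0

end Summit.CriticalPhenomena.SAWScalingLimit.Theorems.PolygonParitySqueeze.PolygonGreen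

end
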